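import Literature.Probability.LatticeModels.ScaleFrameKernelTerm
import Literature.Probability.LatticeModels.ScaleFrameKernelJunk
import HarnessLib

/-!
# Kesten's kernel on a scale frame: the product structure of a kernel entry (proved)

Topic `Literature/Probability/LatticeModels` (trunk `StatMech`, family `crit-ising`). The penultimate
step of the cross-ratio bound of the chain kernel of Kesten's ratio-limit scheme (H. Kesten, PTRF 73
(1986), §2, Lemma (23); D. Basu, A. Sapozhnikov, ECP 22 (2017), §2, eq. (2.9)) on an abstract
`ScaleFrame`: the kernel entry `N(o, d') = P[Fo ∩ Fd(d') ∩ {R' ↔ R inside Wo ∖ U'}]` of an outer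
context `o = (Fo, Wo, R)` and an inner datum `d' = (U', R')` (free random-cluster measure `P` of the
frame, datum event with the rim wired off the inside) is, within the factors `q²/c²` above and `q²/c⁶`
below, a PRODUCT `π(d') · S(o)` (`ScaleFrame.kernel_entry_bounds`): Markov at the inner datum
(`rcMeasure_real_datumOffT_two_block_bounds`) reduces to the outside measure `μ_{d'}` of the context
event; its partition by the datum of the gap exploration (`rcMeasure_real_eq_sum_datumOff_add`) has
terms bounded on both sides by `Θ(o; X, Y) g₁(d')` (`ScaleFrame.kernel_term_bounds`) and a junk part of
relative size `≤ 1 - c` (`ScaleFrame.rcMeasure_real_inter_notWiredOff_le`).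
Everything is proved; no definitions, no named facts.

## References

* [Kesten1986] H. Kesten, *Probab. Theory Related Fields* 73 (1986) 369–394, §2, Lemma (23).
* [BasuSapozhnikov2017ECP] D. Basu, A. Sapozhnikov, *Electron. Commun. Probab.* 22 (2017) no. 26,
  §2, eq. (2.9).
-/

noncomputable section

open scoped Classical
open MeasureTheory Finset SimpleGraph
open Literature.Probability.Percolation (BondConfig openConnIn openCrossing explSet explRim explEvent
  mem_explEvent_iff mem_explRim_iff)

namespace Literature.Probability.LatticeModels

namespace ScaleFrame

variable {V : Type*} [Fintype V] [DecidableEq V] (F : ScaleFrame V)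

/-- Arithmetic of a kernel entry: from `N ≤ q P A`, `P A ≤ q N`, `A = main + J`, `0 ≤ J ≤ (1-c) A`,
`main ≤ (q/c) (S g)`, `c⁶ (S g) ≤ q main` (`0 ≤ P, J`, `0 < c`, `0 ≤ q`) follow
`N ≤ (q²/c²) (P g S)` and `P g S ≤ (q²/c⁶) N`. [folklore] -/
theorem kernel_entry_arith {q c N P A main J g S : ℝ} (hq : 0 ≤ q) (hc : 0 < c) (hP : 0 ≤ P)
    (hJ : 0 ≤ J) (h1 : N ≤ q * P * A) (h2 : P * A ≤ q * N) (h3 : A = main + J)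
    (h4 : J ≤ (1 - c) * A) (h5 : main ≤ q / c * (S * g)) (h6 : c ^ 6 * (S * g) ≤ q * main) :
    N ≤ q ^ 2 / c ^ 2 * (P * g * S) ∧ P * g * S ≤ q ^ 2 / c ^ 6 * N := by
  have hcA : c * A ≤ main := by nlinarith
  have hmA : main ≤ A := by linarith
  constructor
  · have hA : A ≤ q / c ^ 2 * (S * g) := by
      have : c * A ≤ q / c * (S * g) := hcA.trans h5
      calc A = c * A / c := by field_simp
        _ ≤ q / c * (S * g) / c := div_le_div_of_nonneg_right this hc.le
        _ = q / c ^ 2 * (S * g) := by field_simp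
    calc N ≤ q * P * A := h1
      _ ≤ q * P * (q / c ^ 2 * (S * g)) := mul_le_mul_of_nonneg_left hA (mul_nonneg hq hP)
      _ = q ^ 2 / c ^ 2 * (P * g * S) := by field_simp
  · have h7 : c ^ 6 * (P * g * S) ≤ q ^ 2 * N :=
      calc c ^ 6 * (P * g * S) = P * (c ^ 6 * (S * g)) := by ring
        _ ≤ P * (q * main) := mul_le_mul_of_nonneg_left h6 hP
        _ ≤ P * (q * A) := mul_le_mul_of_nonneg_left (mul_le_mul_of_nonneg_left hmA hq) hP
        _ = q * (P * A) := by ring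
        _ ≤ q * (q * N) := mul_le_mul_of_nonneg_left h2 hq
        _ = q ^ 2 * N := by ring
    calc P * g * S = c ^ 6 * (P * g * S) / c ^ 6 := by field_simp
      _ ≤ q ^ 2 * N / c ^ 6 := div_le_div_of_nonneg_right h7 (by positivity)
      _ = q ^ 2 / c ^ 6 * N := by ring

/-- **The kernel entry is a product, up to constants** (Kesten 1986, proof of Lemma (23);
Basu–Sapozhnikov 2017, eq. (2.9)). For a scale frame with ladder `LadderRSWb p q c a M (m+16+g) 13`
(`M ≥ 4`, `g ≥ 1`, `aM^{m+16+g} ≤ Rmax`, `η ≤ a`, `0 < c ≤ 1`, `q ≥ 1`) there are nonnegative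
functions `π` of the inner datum `(U', R')` alone and `S` of the outer context `(Fo, Wo, R)` alone such
that every kernel entry `N(o, d') = P[Fo ∩ Fd(d') ∩ {R' ↔ R inside Wo ∖ U'}]` (free measure `P` of
the frame; `Fd` the datum event of the exploration of `annSet a (aM^m)` from `inSet a` with the rim wired
off the inside; inner data of radii `< aM^m + η`; `Fo` read on the frame edges beyond radius
`aM^{m+16+g}`, `Wo ⊇ {good, rad < aM^{m+16+g}}`, `R ⊆ Wo` beyond radius `aM^{m+16+g}`) satisfies
`N(o, d') ≤ (q²/c²) π(d') S(o)` and `π(d') S(o) ≤ (q²/c⁶) N(o, d')`.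
[cite: Kesten1986, §2 Lemma (23)] -/
theorem kernel_entry_bounds {p q c a M : ℝ} {m g : ℕ}
    (hp : p ∈ Set.Ico (0 : ℝ) 1) (hq : 1 ≤ q) (hc : 0 < c) (hc1 : c ≤ 1) (ha : 0 < a) (hM : 4 ≤ M)
    (hg : 1 ≤ g) (hR : a * M ^ (m + 16 + g) ≤ F.Rmax) (hη : F.η ≤ a)
    (hL : F.LadderRSWb p q c a M (m + 16 + g) 13)
    (Nf : Set (BondConfig V) → Set V → Set V → Set V → Set V → ℝ)
    (hNf : Nf = fun Fo₀ Wo₀ R₀ U₀ R₀' => (rcMeasure (fromEdgeSet (↑F.E : Set (Sym2 V))) p q ∅).real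
      (Fo₀ ∩ {ω | ω ∩ (↑F.E : Set (Sym2 V)) ∈
        explEvent (F.inSet a) (F.annSet a (a * M ^ m)) U₀ R₀' ∩
          {ω | ∀ r ∈ R₀', ∀ r₂ ∈ R₀', ∃ v ∈ U₀ \ F.inSet a, ∃ v' ∈ U₀ \ F.inSet a,
            s(v, r) ∈ ω ∧ s(v', r₂) ∈ ω ∧ ω ∈ openConnIn (U₀ \ F.inSet a) v v'}} ∩
        openCrossing (Wo₀ \ U₀) R₀' R₀)) :
    ∃ (π : Set V → Set V → ℝ) (S : Set (BondConfig V) → Set V → Set V → ℝ),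
      (∀ U₀ R₀, 0 ≤ π U₀ R₀) ∧ (∀ Fo₀ Wo₀ R₀, 0 ≤ S Fo₀ Wo₀ R₀) ∧
      ∀ (U' R' : Set V), (∀ v ∈ U', v ∈ F.good ∧ F.rad v < a * M ^ m) →
        (∀ v ∈ R', v ∈ F.good ∧ F.rad v < a * M ^ m + F.η) →
      ∀ (Fo : Set (BondConfig V)) (Wo R : Set V),
        (∀ ω₁ ω₂ : BondConfig V, (∀ e ∈ F.E,
          (∀ x ∈ e, x ∈ F.outSet (a * M ^ (m + 16)) (a * M ^ (m + 16 + g))) → (e ∈ ω₁ ↔ e ∈ ω₂)) →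
          (ω₁ ∈ Fo ↔ ω₂ ∈ Fo)) →
        (∀ v : V, v ∈ F.good → F.rad v < a * M ^ (m + 16 + g) → v ∈ Wo) →
        R ⊆ Wo ∩ F.outSet (a * M ^ (m + 16)) (a * M ^ (m + 16 + g)) →
        Nf Fo Wo R U' R' ≤ q ^ 2 / c ^ 2 * (π U' R' * S Fo Wo R) ∧
          π U' R' * S Fo Wo R ≤ q ^ 2 / c ^ 6 * Nf Fo Wo R U' R' := by
  subst hNf
  have hp' : p ∈ Set.Icc (0 : ℝ) 1 := ⟨hp.1, hp.2.le⟩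
  have hq0 : 0 < q := one_pos.trans_le hq
  -- the two factors
  refine ⟨fun U' R' => (rcMeasure (fromEdgeSet (↑F.E : Set (Sym2 V))) p q ∅).real
      {ω | ω ∩ (↑F.E : Set (Sym2 V)) ∈ explEvent (F.inSet a) (F.annSet a (a * M ^ m)) U' R' ∩
        {ω | ∀ r ∈ R', ∀ r₂ ∈ R', ∃ v ∈ U' \ F.inSet a, ∃ v' ∈ U' \ F.inSet a,
          s(v, r) ∈ ω ∧ s(v', r₂) ∈ ω ∧ ω ∈ openConnIn (U' \ F.inSet a) v v'}} *
      (rcMeasure (fromEdgeSet (↑(F.edgesWithin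
        {v | v ∈ F.good ∧ v ∉ U' ∧ F.rad v < a * M ^ (m + 1) * M ^ 6}) : Set (Sym2 V))) p q
        (R' ∪ {v | a * M ^ (m + 1) * M ^ 6 - F.η ≤ F.rad v})).real
        (openCrossing {v | v ∈ F.good ∧ v ∉ U' ∧ F.rad v < a * M ^ (m + 1) * M ^ 6} R'
          ({v | v ∈ F.good ∧ v ∉ U' ∧ F.rad v < a * M ^ (m + 1) * M ^ 6} ∩
            {v | a * M ^ (m + 1) * M ^ 3 ≤ F.rad v})),
    fun Fo Wo R => ∑ d ∈ (Finset.univ : Finset (Finset V × Finset V)), (fun X Y : Set V =>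
      (rcMeasure (fromEdgeSet
        (↑(F.E \ F.edgesWithin (F.inSet (a * M ^ (m + 15) / M ^ 3))) : Set (Sym2 V))) p q ∅).real
        ({ω | ω ∩ (↑(F.E.filter fun e => ¬ e.IsDiag ∧ ∃ v ∈ X, v ∈ e) : Set (Sym2 V)) ∈
          explEvent (F.outSet (a * M ^ (m + 15)) (a * M ^ (m + 15) * M))
            (F.annSet (a * M ^ (m + 15)) (a * M ^ (m + 15) * M)) X Y ∩
          {ω | ∀ r ∈ Y, ∀ r₂ ∈ Y, ∃ v ∈ X \ F.outSet (a * M ^ (m + 15)) (a * M ^ (m + 15) * M),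
            ∃ v' ∈ X \ F.outSet (a * M ^ (m + 15)) (a * M ^ (m + 15) * M),
              s(v, r) ∈ ω ∧ s(v', r₂) ∈ ω ∧
                ω ∈ openConnIn (X \ F.outSet (a * M ^ (m + 15)) (a * M ^ (m + 15) * M)) v v'}} ∩
        ({ω | ω ∩ (↑(F.E.filter fun e => ¬ e.IsDiag ∧
            ∀ x ∈ e, x ∈ F.outSet (a * M ^ (m + 16)) (a * M ^ (m + 16 + g))) : Set (Sym2 V)) ∈ Fo} ∩
          {ω | ∃ y ∈ Y, ∃ v ∈ X,
            s(v, y) ∈ ω ∩ (↑(F.E.filter fun e => ¬ e.IsDiag ∧ ∃ v ∈ X, v ∈ e) : Set (Sym2 V)) ∧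
            ω ∩ (↑(F.E.filter fun e => ¬ e.IsDiag ∧ ∃ v ∈ X, v ∈ e) : Set (Sym2 V)) ∈
              openCrossing (X ∩ Wo) {v} R})) *
      (rcMeasure (fromEdgeSet (↑(F.edgesWithin
        {v | v ∉ X ∧ a * M ^ (m + 1) * M ^ 8 < F.rad v}) : Set (Sym2 V))) p q
        (Y ∪ {v | F.rad v ≤ a * M ^ (m + 1) * M ^ 8 + F.η})).real
        (openCrossing {v | v ∉ X ∧ a * M ^ (m + 1) * M ^ 8 < F.rad v}
          ({v | v ∉ X ∧ a * M ^ (m + 1) * M ^ 8 < F.rad v} ∩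
            {v | F.rad v ≤ a * M ^ (m + 1) * M ^ 11}) Y)) (↑d.1 : Set V) (↑d.2 : Set V),
    fun _ _ => mul_nonneg measureReal_nonneg measureReal_nonneg,
    fun _ _ _ => Finset.sum_nonneg fun _ _ => mul_nonneg measureReal_nonneg measureReal_nonneg,
    fun U' R' hU' hR' Fo Wo R hFo hWo hRR => ?_⟩

  beta_reduce
  haveI := isProbabilityMeasure_rcMeasure (fromEdgeSet (↑F.E : Set (Sym2 V))) hp' hq0 ∅
  obtain ⟨hs1, -, hs3, hs4, hs5, hs6, hbpos⟩ := F.gap_scales ha hM hR hη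
  have hηpos := F.η_pos
  have hmb : a * M ^ (m + 1) + a ≤ a * M ^ (m + 15) := scale_gap ha hM (by omega)
  have hbb : a * M ^ (m + 15) < a * M ^ (m + 15) * M := by linarith
  have hb'R : a * M ^ (m + 15) * M ≤ F.Rmax := by rw [hs4]; exact hs6
  -- abbreviations
  set GdIn : Set (BondConfig V) := explEvent (F.inSet a) (F.annSet a (a * M ^ m)) U' R' ∩
    {ω | ∀ r ∈ R', ∀ r₂ ∈ R', ∃ v ∈ U' \ F.inSet a, ∃ v' ∈ U' \ F.inSet a,
      s(v, r) ∈ ω ∧ s(v', r₂) ∈ ω ∧ ω ∈ openConnIn (U' \ F.inSet a) v v'} with hGdIn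
  set T' : Finset (Sym2 V) := F.E.filter fun e => ¬ e.IsDiag ∧ ∃ v ∈ U', v ∈ e with hT'
  set E₁ : Finset (Sym2 V) := (F.E.filter fun e => ¬ e.IsDiag) \ T' with hE₁
  set D₀ : Finset (Sym2 V) := F.E.filter fun e =>
    ¬ e.IsDiag ∧ ∀ x ∈ e, x ∈ F.outSet (a * M ^ (m + 16)) (a * M ^ (m + 16 + g)) with hD₀
  set Fo₁ : Set (BondConfig V) := {ω | ω ∩ (↑D₀ : Set (Sym2 V)) ∈ Fo} with hFo₁
  set A' : Set (BondConfig V) := {ω | ω ∩ (↑E₁ : Set (Sym2 V)) ∈ openCrossing (Wo \ U') R' R}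
    with hA'
  set FdT : Set (BondConfig V) := {ω | ω ∩ (↑T' : Set (Sym2 V)) ∈ GdIn} with hFdT
  have hE₁E : E₁ ⊆ F.E := Finset.sdiff_subset.trans (Finset.filter_subset _ _)
  -- readings on lattice configurations
  have hlat : ∀ ω : BondConfig V, ω ⊆ (fromEdgeSet (↑F.E : Set (Sym2 V))).edgeSet →
      ∀ e ∈ ω, e ∈ F.E ∧ ¬ e.IsDiag := fun ω hω e he => by
    have := hω he
    rw [edgeSet_fromEdgeSet] at this
    exact ⟨this.1, this.2⟩
  have hread : ∀ ω : BondConfig V, ω ⊆ (fromEdgeSet (↑F.E : Set (Sym2 V))).edgeSet →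
      (ω ∩ ↑F.E ∈ GdIn ↔ ω ∈ FdT) := fun ω hω =>
    explEventOff_iff_of_agree fun e he =>
      ⟨fun h => ⟨h.1, Finset.mem_coe.2 (Finset.mem_filter.2 ⟨h.2, (hlat ω hω e h.1).2, he⟩)⟩,
        fun h => ⟨h.1, Finset.filter_subset _ _ (Finset.mem_coe.1 h.2)⟩⟩
  have hcross : ∀ ω : BondConfig V, ω ⊆ (fromEdgeSet (↑F.E : Set (Sym2 V))).edgeSet →
      (ω ∈ openCrossing (Wo \ U') R' R ↔ ω ∈ A') := by
    intro ω hω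
    refine ⟨fun ⟨x, hx, y, hy, h⟩ => ⟨x, hx, y, hy, ?_⟩, fun h =>
      Percolation.isUpperSet_openCrossing _ _ _ (Set.inter_subset_left : ω ∩ ↑E₁ ⊆ ω) h⟩
    refine Percolation.BlockExploration.openConnIn_of_agree h fun u hu w hw huw => ⟨huw, ?_⟩
    refine Finset.mem_coe.2 (Finset.mem_sdiff.2 ⟨Finset.mem_filter.2 (hlat ω hω _ huw), fun hT => ?_⟩)
    obtain ⟨-, -, v, hvU, hv⟩ := Finset.mem_filter.1 hT
    rcases Sym2.mem_iff.1 hv with rfl | rfl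
    exacts [hu.2 hvU, hw.2 hvU]
  have hFoD : ∀ ω : BondConfig V, ω ⊆ (fromEdgeSet (↑F.E : Set (Sym2 V))).edgeSet →
      (ω ∈ Fo ↔ ω ∈ Fo₁) := fun ω hω =>
    hFo ω (ω ∩ ↑D₀) fun e he hall =>
      ⟨fun h => ⟨h, Finset.mem_coe.2 (Finset.mem_filter.2 ⟨he, (hlat ω hω e h).2, hall⟩)⟩,
        fun h => h.1⟩
  have hNeq : (rcMeasure (fromEdgeSet (↑F.E : Set (Sym2 V))) p q ∅).real
      (Fo ∩ {ω | ω ∩ ↑F.E ∈ GdIn} ∩ openCrossing (Wo \ U') R' R) =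
      (rcMeasure (fromEdgeSet (↑F.E : Set (Sym2 V))) p q ∅).real (FdT ∩ Set.univ ∩ (A' ∩ Fo₁)) := by
    refine measureReal_congr (rcMeasure_ae_eq_of_forall_subset_edgeSet _ hp' hq0 ∅ fun ω hω => ?_)
    rw [Set.mem_inter_iff, Set.mem_inter_iff, Set.mem_inter_iff, Set.mem_inter_iff,
      Set.mem_inter_iff, Set.mem_setOf_eq, hread ω hω, hcross ω hω, hFoD ω hω]
    simp only [Set.mem_univ, and_true]
    tauto
  have hPd : (rcMeasure (fromEdgeSet (↑F.E : Set (Sym2 V))) p q ∅).real {ω | ω ∩ ↑F.E ∈ GdIn} =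
      (rcMeasure (fromEdgeSet (↑F.E : Set (Sym2 V))) p q ∅).real FdT :=
    measureReal_congr (rcMeasure_ae_eq_of_forall_subset_edgeSet _ hp' hq0 ∅ fun ω hω => hread ω hω)
  -- a void datum event: both sides vanish
  by_cases hne : FdT.Nonempty
  swap
  · have h0 : FdT = ∅ := Set.not_nonempty_iff_eq_empty.1 hne
    rw [hNeq, hPd, h0]
    simp
  obtain ⟨ω₁, hω₁⟩ := hne
  have hRU : ∀ r ∈ R', r ∉ U' := by
    obtain ⟨h1, h2⟩ := mem_explEvent_iff.1 hω₁.1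
    intro r hr hrU
    rw [← h1] at hrU
    rw [← h2] at hr
    exact (mem_explRim_iff.1 hr).1 hrU
  -- (1) Markov at the inner datum
  have hedgeG : ∀ i, @edgeFinset V (fromEdgeSet (↑F.E : Set (Sym2 V))) i =
      F.E.filter fun e => ¬ e.IsDiag := fun i => Finset.ext fun e => by
    rw [mem_edgeFinset_fromEdgeSet_iff, Finset.mem_filter]
  have hT'G : ∀ i, ∀ e, e ∈ T' ↔
      e ∈ @edgeFinset V (fromEdgeSet (↑F.E : Set (Sym2 V))) i ∧ ∃ v ∈ U', v ∈ e := fun i e => by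
    rw [hedgeG i, Finset.mem_filter, Finset.mem_filter, and_assoc]
  have hD₀E₁ : (↑D₀ : Set (Sym2 V)) ⊆ ↑E₁ := fun e he => by
    obtain ⟨heE, hnd, hall⟩ := Finset.mem_filter.1 (Finset.mem_coe.1 he)
    refine Finset.mem_coe.2 (Finset.mem_sdiff.2 ⟨Finset.mem_filter.2 ⟨heE, hnd⟩, fun hT => ?_⟩)
    obtain ⟨-, -, u, huU, hue⟩ := Finset.mem_filter.1 hT
    have hs := scale_mono ha hM (show m ≤ m + 16 by omega)
    exact hall u hue (Or.inl ⟨(hU' u huU).1, by linarith [(hU' u huU).2]⟩)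
  have hM4 := rcMeasure_real_datumOffT_two_block_bounds (fromEdgeSet (↑F.E : Set (Sym2 V))) hp' hq
    ∅ (F.inSet a) (F.annSet a (a * M ^ m)) U' R' (fun b hb => (Set.notMem_empty b hb).elim) T'
    (hT'G _) Set.univ (fun _ _ _ => Iff.rfl) (A' ∩ Fo₁) (fun ω₁ ω₂ h => by
      rw [hedgeG, ← hE₁] at h
      have hD : ω₁ ∩ (↑D₀ : Set (Sym2 V)) = ω₂ ∩ ↑D₀ := by
        rw [← Set.inter_eq_right.2 hD₀E₁, ← Set.inter_assoc, h, Set.inter_assoc]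
      simp only [hA', hFo₁, Set.mem_inter_iff, Set.mem_setOf_eq, h, hD])
  simp only [hedgeG] at hM4
  rw [← hE₁, Set.union_empty, Set.inter_univ, ← hGdIn, ← hFdT] at hM4
  rw [Set.inter_univ] at hNeq
  obtain ⟨hM4a, hM4b⟩ := hM4
  rw [← hPd] at hM4a hM4b
  -- (2) partition of the outside by the gap datum, and the junk
  have hpart := rcMeasure_real_eq_sum_datumOff_add (fromEdgeSet (↑E₁ : Set (Sym2 V))) hp' hq0 R'
    (↑E₁ : Set (Sym2 V)) (F.outSet (a * M ^ (m + 15)) (a * M ^ (m + 15) * M))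
    (F.annSet (a * M ^ (m + 15)) (a * M ^ (m + 15) * M)) (A' ∩ Fo₁)
  have hSB : F.SepBound p q c (a * M ^ (m + 15)) (a * M ^ (m + 15) * M) := by
    have h := ScaleFrame.LadderRSWb.sepBound F hL (by norm_num) (i := m + 15) (by omega)
    rwa [show a * M ^ (m + 15 + 1) = a * M ^ (m + 15) * M by ring] at h
  have hTE : ∀ e ∈ F.edgesTouching (F.annSet (a * M ^ (m + 15)) (a * M ^ (m + 15) * M)),
      ¬ e.IsDiag → e ∈ E₁ := by
    intro e he hnd
    obtain ⟨heE, v, hve, hv⟩ := F.mem_edgesTouching.1 he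
    refine Finset.mem_sdiff.2 ⟨Finset.mem_filter.2 ⟨heE, hnd⟩, fun hT => ?_⟩
    obtain ⟨-, -, u, huU, hue⟩ := Finset.mem_filter.1 hT
    obtain ⟨-, hvr⟩ := F.adj_good e heE u hue v hve (hU' u huU).1 (by linarith [(hU' u huU).2])
    linarith [(abs_lt.1 hvr).2, (hU' u huU).2, hv.2.1]
  have hBenv : ∀ v ∈ R', ∀ e ∈ F.edgesTouching (F.annSet (a * M ^ (m + 15)) (a * M ^ (m + 15) * M)),
      v ∉ e := by
    intro v hv e he hve
    obtain ⟨heE, w, hwe, hw⟩ := F.mem_edgesTouching.1 he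
    obtain ⟨-, hvr⟩ := F.adj_good e heE w hwe v hve hw.1 (by linarith [hw.2.2])
    linarith [(abs_lt.1 hvr).1, (hR' v hv).2, hw.2.1]
  have hA'up : IsUpperSet A' := fun ω₁ ω₂ hle h =>
    Percolation.isUpperSet_openCrossing _ _ _ (Set.inter_subset_inter_left _ hle) h
  have hFo₁det : ∀ ω₁ ω₂ : BondConfig V,
      (∀ e, e ∉ F.edgesTouching (F.annSet (a * M ^ (m + 15)) (a * M ^ (m + 15) * M)) →
        (e ∈ ω₁ ↔ e ∈ ω₂)) → (ω₁ ∈ Fo₁ ↔ ω₂ ∈ Fo₁) := by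
    intro ω₁ ω₂ h
    have hD : ω₁ ∩ (↑D₀ : Set (Sym2 V)) = ω₂ ∩ ↑D₀ := by
      refine Set.ext fun e => ⟨fun he => ⟨(h e ?_).1 he.1, he.2⟩, fun he => ⟨(h e ?_).2 he.1, he.2⟩⟩ <;>
      · intro heB
        obtain ⟨-, -, hall⟩ := Finset.mem_filter.1 (Finset.mem_coe.1 he.2)
        obtain ⟨-, v, hve, hv⟩ := F.mem_edgesTouching.1 heB
        exact hall v hve (Or.inl ⟨hv.1, by linarith [hv.2.2]⟩)
    simp only [hFo₁, Set.mem_setOf_eq, hD]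
  have hjunk := F.rcMeasure_real_inter_notWiredOff_le hp hq hc1 hSB E₁ hTE R' hBenv (↑E₁ : Set (Sym2 V))
    (Finset.coe_subset.2 hE₁E) (fun e he hnd => Finset.mem_coe.2 (hTE e he hnd)) hA'up hFo₁det
  simp only at hjunk
  -- (3) the terms
  have hterm : ∀ X Y : Set V, _ := fun X Y =>
    F.kernel_term_bounds hp hq hc ha hM hg hR hη hL hU' hR' hRU hWo hRR Fo X Y
  have hsum1 := Finset.sum_le_sum fun (d : Finset V × Finset V) (_ : d ∈ Finset.univ) =>
    (hterm ↑d.1 ↑d.2).1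
  have hsum2 := Finset.sum_le_sum fun (d : Finset V × Finset V) (_ : d ∈ Finset.univ) =>
    (hterm ↑d.1 ↑d.2).2
  rw [← Finset.mul_sum, ← Finset.sum_mul] at hsum1
  rw [← Finset.mul_sum, ← Finset.sum_mul, ← Finset.mul_sum] at hsum2
  -- fold the abbreviations in the terms (syntactic bookkeeping for the final step)
  rw [← hT', ← hE₁, ← hD₀, ← hFo₁, ← hA'] at hsum1 hsum2
  -- (4) arithmetic
  rw [hNeq]
  exact kernel_entry_arith hq0.le hc measureReal_nonneg measureReal_nonneg hM4a hM4b hpart hjunk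
    hsum1 hsum2

end ScaleFrame

end Literature.Probability.LatticeModels

end
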